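import Literature.MathematicalPhysics.QuantumFieldTheory.Balaban1983to89.Node00.RateRecordW1MapsAdm
import Summits.QuantumFields.YangMills.Theorems.BalabanUVNodesN18AtReadingOfRecord12Levels

/-!
# BalabanUVNodes ∕ node N18 = NE5 — N18 AT THE ADMISSIBLE READING OF RECORD (background slots = the fields READ INSIDE the space tables): the statement of
# record asked exactly in the print's regime, the END junction of module 11 with its two configuration-direction embedding clauses DISCHARGED, and the
# comparison with the all-fields statement of record (Track A, DAG node N18 = `T4OutputRate.NE5` :211; cluster K4 «SpineRates», item K3′
# `SpineGivenEndpointR12`; module 12 of seat pub-ymgap-dag-n18-d, strategy s2)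

HONEST FRAMING.  Count-neutral kernel bookkeeping (`--supports stmt-QuantumFields-19908 --as helper`), composition BY NAME of landed theorems; NE5 is NOT
PRINTED and NOT proved; N18 is NOT discharged; no inhabitant of `IsDatumOfRecord₁₂C` is claimed (K0′).

WHY.  node00-def-W1 g3's level pairing of record takes ALL `SU(N)` gauge fields as run backgrounds, so N18's statement of record at the reading of record
(module 10 `s_N18_readingOfRecord₁₂_ofRecord_iff`, p474555) asks the η-rate inequality at EVERY field — beyond the print's regime ([I] (1.18) p. 263 «for (𝐔, 𝐉) ∈
U^c_j(X, α₀, α₁)»; [II] (2.16)–(2.18) p. 16) — and module 11's junction (`s_N18_readingOfRecord₁₂_ofRecord_of_envelope_bound238`, p476400) carries the clauses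
`hembA : ∀ j U X, (ιU, 0) ∈ spA j X` ∕ `hembB`, which at tables inside the analyticity domains fail for large `U` (located independently by dag-n18-c g3 —
HANDOFF «the carriers' background type should be the restricted configurations» — and by dag-n22-c g3, LOCATED-BGA).  At THE ADMISSIBLE READING OF RECORD
(`Node00/RateRecordW1MapsAdm` — typed by dag-n22-c g3 as repair (R1) of its LOCATED-BGA, endorsed and filed by the object's definer node00-def-W1 g4: `AdmBg F M N sp k` = the gauge fields of the `k`-th torus whose reading
`(ιU, 0)` lies in every entry `sp k j Y` of a space-table family `sp`; `LevelPairing.ofRecordAdm` ∕ `ReadingData.ofRecordAdm` = the pairing ∕ reading of record with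
both background slots := `AdmBg`, readings `ι ∘ val`, `pair := pairOfRecord`, transport `T₀` restricted along the DISPLAYED preservation clause `hT₀`) both clauses
are projections (`LevelPairing.ofRecordAdm_embA_mem` ∕ `_embB_mem`) and the statement of record is asked exactly where the print asserts anything.  This file is
N18's side at that reading (dag-n22-c's modules 9 ∕ 12 are N22's).

WHAT.
* §1 `n18At_pairingAdm_of_envelope_bound238` — module 11 §1 at the admissible pairing of record: the END's data over its carriers + the towers' `AnalyticH` ∕
  `Bound238` ON THE TABLES `sp k` ∕ `sp (k+1)` ⇒ `N18At ⟨carriers, ]0,γ]^ℕ, γ, κ, EA, EB, θ′, C₅(C₃ε₁), …⟩` — NO embedding clause (`ofRecordAdm_embA_mem` ∕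
  `ofRecordAdm_embB_mem`), NO pairing clause (`dj_pairOfRecord`); and the two levels leaves alone, `decayBound_EA_ofRecordAdm_of_bound238` (L05) ∕
  `decayBound_EB_ofRecordAdm_of_bound238` (L06) — [I] (1.18) for both runs' (2.13) terms at every admissible field from the H-layer data on the tables, NO clause
  (dag-n18-c's any-table producers `decayBound_EA∕EB_of_bound238_table`, p474817, at the admissible pairing).
* §2 the statement of record AT THE ADMISSIBLE READING: `n18At_readingAdm_iff` (per level, `Iff.rfl`), `s_N18_readingAdm₁₂_iff` (closed form: the inequality for
  every ADMISSIBLE run-B field, i.e. read inside `sp F θ (k+1)`), `rate_of_s_N18_readingAdm₁₂`, `s_N18_readingAdm₁₂_of_forall`.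
* §3 `s_N18_readingAdm₁₂_of_envelope_bound238` — THE ROW AT THE ADMISSIBLE READING: END data + H-layer configuration data of the towers of record on the tables
  `sp F θ k`, `sp F θ (k+1)` ⇒ `S_N18 (RRec₁₂ 𝔯_adm)`; what REMAINS displayed is (i) the END's data-direction datum and leaves (dag-n18-c s1 ∕ NODE O ∕
  rows NE2–NE3), (ii) `AnalyticH` + `Bound238` of the towers on the tables (NODE A's (2.38) ∕ N10's Lemmas 1–3; n18-c's `…Lemma3Config` from per-term
  (2.26)), (iii) `hT` (regularity of averages), (iv) the towers `S` (node00-def-W1 g4), K0′.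
* §4 COMPARISON: `s_N18_readingAdm₁₂_of_allFields` (the all-fields statement at the same towers ∕ transport ⇒ the admissible statement, any tables),
  `s_N18_readingAdm₁₂_antitone` (larger tables ⇒ stronger statement), `s_N18_readingAdmOfRecord₁₂_of_ofRecord` (module 10's statement of record with the
  transport of record PINNED ⇒ the admissible statement with the transport of record).
* §5 HONESTY: `s_N18_readingAdm₁₂_of_forall_exists_empty` — if at every admissible tuple and level some entry of the run-B table is EMPTY the admissible
  statement holds outright (no run-B field is admissible): its content is through INHABITED tables (at the table of record, in the window, `U ≡ 1` is
  admissible — `Node00.one_mem_spaceI_stage12`; the positive hook is `AdmBg.nonempty_of_mem`).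

One finite four-torus programme at fixed `ε`; NOT the continuum limit, NOT OS, NOT a mass gap, NOT Clay.  0 `def`, 0 `sorry`.  Sources (TYPES only): T. Bałaban, CMP **109** (1987) [Balaban1987RG1] (0.8)–(0.10) p. 253, (0.24)–(0.25) p. 257, Thm 1 p. 259, (1.11)–(1.16) p. 262,
(1.17)–(1.18) p. 263; CMP **116** (1988) [Balaban1988RG2Cluster] (2.13)–(2.14) pp. 14–15, (2.16)–(2.18) p. 16, Lemma 3 (2.38) p. 20, (2.41) p. 21; CMP **119**
(1988) [Balaban1988Convergent] (2.28) p. 259; CMP **98** (1985) [Balaban1985Averaging] Props. 1–2; R. Kotecký–D. Preiss, CMP **103** (1986) [KoteckyPreiss1986].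
-/

noncomputable section

open Set Metric
open scoped Matrix.Norms.L2Operator

namespace YMDAG.N18.W1Reading
open Literature.MathematicalPhysics.QuantumFieldTheory.Balaban1983to89
open Literature.MathematicalPhysics.QuantumFieldTheory.Balaban1983to89.T4Continuum
open Literature.MathematicalPhysics.QuantumFieldTheory.Balaban1983to89.T4OutputRate (Carriers Functional NE5 DecayBound Window)
open Literature.MathematicalPhysics.QuantumFieldTheory.Balaban1983to89.T4InputCauchyRateData (StepModel)
open Literature.MathematicalPhysics.QuantumFieldTheory.Balaban1983to89.B13Resummation (locE)
open Literature.MathematicalPhysics.QuantumFieldTheory.Balaban1983to89.TreeLengthTorus (TDom tsys torusTreeLen)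
open Literature.MathematicalPhysics.QuantumFieldTheory.Balaban1983to89.TreeLengthTorusGeometry (TTouch)
open Literature.MathematicalPhysics.QuantumFieldTheory.Balaban1983to89.B12TreeDecay (K₀)
open Literature.MathematicalPhysics.QuantumFieldTheory.Balaban1983to89.Node00 (Stage12Params IsDatumOfRecord₁₂C U3Letters₁₁ U3Objects₁₁ NE2Objects₁₁
  NE3Letters₁₁ RateAssignment₁₂ prependCoupling MatA ιSU avOfRecord)
open Literature.MathematicalPhysics.QuantumFieldTheory.Balaban1983to89.Node00.Sect2 (domCount domSys CPair ofBackgroundC)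
open Literature.MathematicalPhysics.QuantumFieldTheory.Balaban1983to89.Node00.W1 (ReadingData LevelPairing LetterInputs ClusterTower pairOfRecord
  dj_pairOfRecord functionalC functional box SpRestr)
open Summit.QuantumFields.BalabanUV.T4Continuum.B13Carriers (transportRaw)
open Summit.QuantumFields.BalabanUV.T4Continuum.Spine.NE5
open Summit.QuantumFields.YangMills.BalabanUVNodes.N18AtByName (n18At_mono)
open Summit.QuantumFields.YangMills.BalabanUVNodes.N18HLayerW1ConfigRecord (decayBound_EA_of_bound238_table decayBound_EB_of_bound238_table)
open YMDAG.N18.HLayer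
open YMDAG.UVSplit

variable {N : ℕ} [NeZero N]

/-! ## §1 At the admissible pairing of record: module 11 §1 with the embedding and pairing clauses discharged -/

section Pairing

variable {F : T4Family} {M k : ℕ}
  (sp : (k j : ℕ) → (domSys (F.P k) M j).Dom → Set (CPair (F.P k) (MatA N)))
  (gauge : GaugeField (F.P k) 0 (Node00.SU N) → GaugeField (F.P k) 0 (Node00.SU N) → ℝ) (hg : ∀ U U', 0 ≤ gauge U U')
  (transport : GaugeField (F.P (k + 1)) 0 (Node00.SU N) → GaugeField (F.P k) 0 (Node00.SU N))
  (hT : ∀ U : GaugeField (F.P (k + 1)) 0 (Node00.SU N),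
    (∀ (j : ℕ) (Y : (domSys (F.P (k + 1)) M j).Dom), ofBackgroundC (ιSU N) U ∈ sp (k + 1) j Y) →
      ∀ (j : ℕ) (Y : (domSys (F.P k) M j).Dom), ofBackgroundC (ιSU N) (transport U) ∈ sp k j Y)
  (S : ClusterTower (F.P k) (MatA N) M) (S' : ClusterTower (F.P (k + 1)) (MatA N) M)
variable {Op Hist : Type*} [NormedAddCommGroup Op] [NormedSpace ℂ Op] [NormedAddCommGroup Hist] [NormedSpace ℂ Hist]

omit [NeZero N] in
open Classical in
/-- **N18 AT THE ADMISSIBLE PAIRING OF RECORD FROM THE H-LAYER END, LEVELS LEAVES FROM THE TOWERS' H-LAYER DATA ON THE SAME TABLES** [bookkeeping; module 11 §1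
`n18At_pairing_of_envelope_bound238` at `R := LevelPairing.ofRecordAdm F M N k sp gauge hg T₀ hT`].  Objects: the space-table family `sp` (table `sp k` of the
`k`-th torus, `sp (k+1)` of the `(k+1)`-th), the transport `T₀` with its preservation clause `hT`, run A's tower `S`, run B's tower `S′`; the functionals ARE
`EA S g U (j,X) = Re E^{(j)}(X; g; (ιU,0))` at the ADMISSIBLE fields of the `k`-th torus and `EB S′ b g U (j,X) = Re E^{(j+1)}(πX; b∷g; (ιU,0))` at those of the
`(k+1)`-th.  Hypotheses: (i) the END's data on the pairing's carriers —
per-member step models `Mb b` representing (2.13) of activities on the `k`-th torus's catalogue (`hrep`) with THE NODE-A MAJORANT AS HYPOTHESIS at `C₃ε₁`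
(`hH`), L01–L03, rows NE2 ∕ NE3's L07 ∕ L08, the W3 shapes, the located numerals, L10, the sharp clause; (ii) THE TOWERS' H-LAYER DATA IN THE CONFIGURATION
DIRECTION ON THE TABLES THEMSELVES — restriction-closedness, `AnalyticH` + `Bound238` of `S` on `sp k` and of `S′` on `sp (k+1)` at every step, amplitudes `A_A ∕ A_B`,
the two STRICT [KP86] clauses.  GONE w.r.t. module 11 §1: `hembA` ∕ `hembB` (the readings lie in the tables BY CONSTRUCTION of the background types) and `hpair`
(`dj_pairOfRecord`).  Conclusion: `N18At ⟨carriers, ]0,γ]^ℕ, γ, κ, EA S, EB S′, θ′, C₅(C₃ε₁), …⟩` with the levels letters `e·576·K₀(64,8)²·A_A ∕ A_B`.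
[cite: Balaban1988RG2Cluster, (2.13) p.14, p.15, (2.16)–(2.18) p.16 and Lemma 3 (2.38) p.20; Balaban1987RG1, (1.18) p.263 and Thm 1 p.259; KoteckyPreiss1986, Thm 1 p.492] -/
theorem n18At_pairingAdm_of_envelope_bound238
    (Mb : ℝ → StepModel (LevelPairing.ofRecordAdm F M N k sp gauge hg transport hT).carriers Op Hist)
    {act : ℝ → (j : ℕ) → Op × Hist → TDom 4 (domCount (F.P k) M j) → ℂ} {γ C3 ε₁ Rd κ A_A A_B E₁ δ δ' θ θ' cH ω ρ₀ B : ℝ} {k₀ : ℕ}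
    -- (i) the END's data on the pairing's carriers
    (hrep : ∀ b : ℝ, 0 < b → b ≤ γ → ∀ (X : Node00.W1.Dom (F.P k) M) (z : Op × Hist),
      (Mb b).Out X.1 z.1 z.2 X =
        locE (TTouch (d := 4) (N := domCount (F.P k) M X.1)) (fun Z : (tsys 4 (domCount (F.P k) M X.1)).Dom => Z.1) (act b X.1 z) X.2.1)
    (hC3 : 0 ≤ C3) (hε₁ : 0 ≤ ε₁) (hκ : 0 ≤ κ) (hrate : κ + 2 * (64 * Real.log 162) + 2 ≤ Rd)
    (hKP : C3 * ε₁ * Real.exp (5 * κ + 1) * K₀ 64 8 * 9 * 64 ≤ 1)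
    (hH : ∀ b : ℝ, 0 < b → b ≤ γ → ∀ j, ∀ g ∈ Window γ, ∀ (U : (LevelPairing.ofRecordAdm F M N k sp gauge hg transport hT).BgB) (q : Op × Hist),
      q ∈ (Mb b).Base j g U →
      ∃ V : Set (Op × Hist), IsOpen V ∧ (Mb b).box j q ⊆ V ∧
        (∀ Z : TDom 4 (domCount (F.P k) M j), DifferentiableOn ℂ (fun z : Op × Hist => act b j z Z) V) ∧
        (∀ z ∈ V, ∀ Z : TDom 4 (domCount (F.P k) M j), ‖act b j z Z‖ ≤ C3 * ε₁ * Real.exp (-(Rd * torusTreeLen Z.1))))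
    (l01 : ∀ b : ℝ, 0 < b → b ≤ γ → L01 (Mb b) ((LevelPairing.ofRecordAdm F M N k sp gauge hg transport hT).EA S) (Window γ))
    (l02 : ∀ b : ℝ, 0 < b → b ≤ γ → L02 (Mb b) ((LevelPairing.ofRecordAdm F M N k sp gauge hg transport hT).EB S' b) (Window γ))
    (l03 : ∀ b : ℝ, 0 < b → b ≤ γ → L03 (Mb b) ((LevelPairing.ofRecordAdm F M N k sp gauge hg transport hT).EB S' b) (Window γ))
    (l07 : ∀ b : ℝ, 0 < b → b ≤ γ → L07 (Mb b) (Window γ) δ θ)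
    (l08 : ∀ b : ℝ, 0 < b → b ≤ γ → L08 (Mb b) (Window γ) κ (Real.exp 1 * 9 * 64 * K₀ 64 8 ^ 2 * A_B) δ' θ)
    (l09aff : ∀ b : ℝ, 0 < b → b ≤ γ → L09aff (Mb b) (Window γ)) (l09blind : ∀ b : ℝ, 0 < b → b ≤ γ → L09blind (Mb b) (Window γ))
    (l09hom : ∀ b : ℝ, 0 < b → b ≤ γ → L09hom (Mb b) (Window γ))
    (l09unit : ∀ b : ℝ, 0 < b → b ≤ γ → L09unit (Mb b) (Window γ) κ E₁ cH ω)
    (hE₁ : 0 < E₁) (hδ : 0 ≤ δ + δ') (hθ : 0 ≤ θ) (hθθ' : θ ≤ θ') (hθ'1 : θ' ≤ 1) (hcH : 0 ≤ cH) (hω : 0 < ω) (hρ₀ : ρ₀ < 1)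
    (l10near : (δ + δ') * θ ^ k₀ +
      cH * (Real.exp 1 * 9 * 64 * K₀ 64 8 ^ 2 * A_A + Real.exp 1 * 9 * 64 * K₀ 64 8 ^ 2 * A_B) / (1 - ω) ≤ ρ₀)
    (hB : 0 ≤ B) (l10first : ∀ k < k₀, Real.exp 1 * 9 * 64 * K₀ 64 8 ^ 2 * A_A + Real.exp 1 * 9 * 64 * K₀ 64 8 ^ 2 * A_B ≤ B * θ ^ k)
    (hS : Real.exp 1 * 9 * 64 * K₀ 64 8 ^ 2 * C3 * cH * ε₁ < (θ' - ω) * (1 - ρ₀))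
    -- (ii) the towers' H-layer data in the configuration direction ON THE TABLES: run A on `F.P k`
    (hrestrA : ∀ m, SpRestr (sp k (m + 1)))
    (hanA : ∀ m, (S m).AnalyticH (box γ m) (sp k (m + 1))) (h238A : ∀ m, (S m).Bound238 (box γ m) (sp k (m + 1)) A_A Rd) (hAA : 0 ≤ A_A)
    (hsmallA : A_A * Real.exp (5 * κ + 1) * K₀ 64 8 * 9 * 64 < 1)
    -- run B on `F.P (k+1)`
    (hrestrB : ∀ m, SpRestr (sp (k + 1) (m + 1)))
    (hanB : ∀ m, (S' m).AnalyticH (box γ m) (sp (k + 1) (m + 1))) (h238B : ∀ m, (S' m).Bound238 (box γ m) (sp (k + 1) (m + 1)) A_B Rd)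
    (hAB : 0 ≤ A_B)
    (hsmallB : A_B * Real.exp (5 * κ + 1) * K₀ 64 8 * 9 * 64 < 1)
    (Λ : ℕ → ℕ → ℝ) (C₉ ωm cr ρ : ℝ) :
    N18At ⟨(LevelPairing.ofRecordAdm F M N k sp gauge hg transport hT).carriers, Window γ, γ, κ,
      (LevelPairing.ofRecordAdm F M N k sp gauge hg transport hT).EA S, (LevelPairing.ofRecordAdm F M N k sp gauge hg transport hT).EB S', θ',
      (Real.exp 1 * 9 * 64 * K₀ 64 8 ^ 2 * (C3 * ε₁) / (1 - ρ₀) * (δ + δ') + B) * (θ' - ω) /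
        (θ' - (ω + Real.exp 1 * 9 * 64 * K₀ 64 8 ^ 2 * (C3 * ε₁) / (1 - ρ₀) * cH)), Λ, C₉, ωm, cr, ρ⟩ :=
  n18At_pairing_of_envelope_bound238 (LevelPairing.ofRecordAdm F M N k sp gauge hg transport hT) S S' Mb (sp k) (sp (k + 1)) hrep hC3 hε₁ hκ hrate hKP hH l01 l02
    l03 l07 l08 l09aff l09blind l09hom l09unit hE₁ hδ hθ hθθ' hθ'1 hcH hω hρ₀ l10near hB l10first hS
    (fun j U X => LevelPairing.ofRecordAdm_embA_mem F M N k sp gauge hg transport hT U j X) hrestrA hanA h238A hAA hsmallA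
    (fun j U Y => LevelPairing.ofRecordAdm_embB_mem F M N k sp gauge hg transport hT U j Y) (fun X => (dj_pairOfRecord F M k X).symm.le)
    hrestrB hanB h238B hAB hsmallB Λ C₉ ωm cr ρ

omit [NeZero N] in
open Classical in
/-- **L05 AT THE ADMISSIBLE PAIRING OF RECORD — NO CLAUSE** [bookkeeping; dag-n18-c's any-table producer `decayBound_EA_of_bound238_table` (p474817) at
`R := LevelPairing.ofRecordAdm …`, its `hembA` := `ofRecordAdm_embA_mem`]: run A's per-step H-layer data `AnalyticH` + `Bound238` (amplitude `A`, rate `R_r`) ON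
THE TABLE `sp k` itself (restriction-closed), the located rate clause and the STRICT [KP86] clause ⇒ `DecayBound (EA S) (]0,γ]^ℕ) (e·576·K₀(64,8)²·A) r₁` — [I] (1.18)
for run A's (2.13) terms at every ADMISSIBLE field. [cite: Balaban1987RG1, (1.18) p.263; Balaban1988RG2Cluster, p.15, (2.16)–(2.18) p.16 and Lemma 3 (2.38) p.20; KoteckyPreiss1986, Thm 1 p.492] -/
theorem decayBound_EA_ofRecordAdm_of_bound238 {γ A Rr r₁ : ℝ}
    (hrestr : ∀ m, SpRestr (sp k (m + 1))) (han : ∀ m, (S m).AnalyticH (box γ m) (sp k (m + 1)))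
    (h238 : ∀ m, (S m).Bound238 (box γ m) (sp k (m + 1)) A Rr) (hA : 0 ≤ A) (hr₁ : 0 ≤ r₁) (hrate : r₁ + 2 * (64 * Real.log 162) + 2 ≤ Rr)
    (hsmall : A * Real.exp (5 * r₁ + 1) * K₀ 64 8 * 9 * 64 < 1) :
    DecayBound ((LevelPairing.ofRecordAdm F M N k sp gauge hg transport hT).EA S) (Window γ) (Real.exp 1 * 9 * 64 * K₀ 64 8 ^ 2 * A) r₁ :=
  decayBound_EA_of_bound238_table (LevelPairing.ofRecordAdm F M N k sp gauge hg transport hT) S (sp k)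
    (fun j U X => LevelPairing.ofRecordAdm_embA_mem F M N k sp gauge hg transport hT U j X) hrestr han h238 hA hr₁ hrate hsmall

omit [NeZero N] in
open Classical in
/-- **L06 AT THE ADMISSIBLE PAIRING OF RECORD — NO CLAUSE** [bookkeeping; dag-n18-c's `decayBound_EB_of_bound238_table` at `R := LevelPairing.ofRecordAdm …`,
`hembB` := `ofRecordAdm_embB_mem`, `hpair` := `dj_pairOfRecord`]: run B's per-step H-layer data ON THE TABLE `sp (k+1)`, the rate clause, the STRICT clause ⇒ for
every member `b ∈ ]0, γ]`, `DecayBound (EB S′ b) (]0,γ]^ℕ) (e·576·K₀(64,8)²·A) r₁` — [I] (1.18) for run B's first-coupling family at every ADMISSIBLE field; the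
pairing of record preserves `d_j`. [cite: Balaban1987RG1, (0.24)–(0.25) p.257 and (1.18) p.263; Balaban1988RG2Cluster, p.15, (2.16)–(2.18) p.16 and Lemma 3 (2.38) p.20; KoteckyPreiss1986, Thm 1 p.492] -/
theorem decayBound_EB_ofRecordAdm_of_bound238 {γ A Rr r₁ : ℝ}
    (hrestr : ∀ m, SpRestr (sp (k + 1) (m + 1))) (han : ∀ m, (S' m).AnalyticH (box γ m) (sp (k + 1) (m + 1)))
    (h238 : ∀ m, (S' m).Bound238 (box γ m) (sp (k + 1) (m + 1)) A Rr) (hA : 0 ≤ A) (hr₁ : 0 ≤ r₁) (hrate : r₁ + 2 * (64 * Real.log 162) + 2 ≤ Rr)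
    (hsmall : A * Real.exp (5 * r₁ + 1) * K₀ 64 8 * 9 * 64 < 1) {b : ℝ} (hb : b ∈ Ioc (0 : ℝ) γ) :
    DecayBound ((LevelPairing.ofRecordAdm F M N k sp gauge hg transport hT).EB S' b) (Window γ) (Real.exp 1 * 9 * 64 * K₀ 64 8 ^ 2 * A) r₁ :=
  decayBound_EB_of_bound238_table (LevelPairing.ofRecordAdm F M N k sp gauge hg transport hT) S' (sp (k + 1))
    (fun j U Y => LevelPairing.ofRecordAdm_embB_mem F M N k sp gauge hg transport hT U j Y) (fun X => (dj_pairOfRecord F M k X).symm.le) hrestr han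
    h238 hA hr₁ hrate hsmall hb

end Pairing

/-! ## §2 N18's statement of record AT THE ADMISSIBLE READING: per level and in closed form -/

section Record

variable (S : (F : T4Family) → (θ : Stage12Params F N) → (k : ℕ) → ClusterTower (F.P k) (MatA N) θ.τ9.M)
  (sp : (F : T4Family) → (θ : Stage12Params F N) → (k j : ℕ) → (domSys (F.P k) θ.τ9.M j).Dom → Set (CPair (F.P k) (MatA N)))
  (gauge : (F : T4Family) → (θ : Stage12Params F N) → (k : ℕ) → GaugeField (F.P k) 0 (Node00.SU N) → GaugeField (F.P k) 0 (Node00.SU N) → ℝ)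
  (hg : ∀ (F : T4Family) (θ : Stage12Params F N) (k : ℕ) (U U' : GaugeField (F.P k) 0 (Node00.SU N)), 0 ≤ gauge F θ k U U')
  (T₀ : (F : T4Family) → (θ : Stage12Params F N) → (k : ℕ) → GaugeField (F.P (k + 1)) 0 (Node00.SU N) → GaugeField (F.P k) 0 (Node00.SU N))
  (hT : ∀ (F : T4Family) (θ : Stage12Params F N) (k : ℕ) (U : GaugeField (F.P (k + 1)) 0 (Node00.SU N)),
    (∀ (j : ℕ) (Y : (domSys (F.P (k + 1)) θ.τ9.M j).Dom), ofBackgroundC (ιSU N) U ∈ sp F θ (k + 1) j Y) →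
      ∀ (j : ℕ) (X : (domSys (F.P k) θ.τ9.M j).Dom), ofBackgroundC (ιSU N) (T₀ F θ k U) ∈ sp F θ k j X)
  (li : (F : T4Family) → Stage12Params F N → LetterInputs) (ℓ₃ : T4Family → NE3Letters₁₁)
  (ne2 : (F : T4Family) → Stage12Params F N → (ℕ → ℝ) → List (ULoop F) → ℕ → NE2Objects₁₁)
  (ne1 : (F : T4Family) → Stage12Params F N → (ℕ → ℝ) → List (ULoop F) → NE1pCarriers)

/-- **PER LEVEL AT THE ADMISSIBLE READING, `Iff.rfl`**: N18 at the level-`k` bundle of the admissible reading data of record on the table family `sp F θ` IS: for every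
member `b ∈ ]0, θ.γ]`, history `g ∈ ]0, θ.γ]^ℕ`, ADMISSIBLE run-B gauge field `U` of the `(k+1)`-th torus (read inside `sp F θ (k+1)`) and run-A domain `(j, X)`,
`|Re E^{(j)}_{S_k}(X; g; (ι(T₀ U), 0)) − Re E^{(j+1)}_{S_{k+1}}(pairOfRecord (j, X); b∷g; (ιU, 0))| ≤ C₅ · θ₅ ^ j · e^{−κ·d_j(X)}`.
[cite: Balaban1987RG1, (0.24)–(0.25) p.257, Thm 1 p.259 and (1.18) p.263; Balaban1988RG2Cluster, (2.13) p.14 and (2.16)–(2.18) p.16] -/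
theorem n18At_readingAdm_iff (F : T4Family) (θ : Stage12Params F N) (k : ℕ) :
    N18At (u3OfRecord₁₂ θ ((ReadingData.ofRecordAdm F θ.τ9.M N (S F θ) (sp F θ) (gauge F θ) (hg F θ) (T₀ F θ) (hT F θ) (li F θ)).u3Objects θ.γ) k) ↔
      ∀ b : ℝ, 0 < b → b ≤ θ.γ → ∀ g ∈ Window θ.γ,
        ∀ (U : {U : GaugeField (F.P (k + 1)) 0 (Node00.SU N) //
            ∀ (j : ℕ) (Y : (domSys (F.P (k + 1)) θ.τ9.M j).Dom), ofBackgroundC (ιSU N) U ∈ sp F θ (k + 1) j Y})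
          (X : Node00.W1.Dom (F.P k) θ.τ9.M),
        |(functionalC (S F θ k) g (ofBackgroundC (ιSU N) (T₀ F θ k U.1)) X).re -
            (functionalC (S F θ (k + 1)) (prependCoupling b g) (ofBackgroundC (ιSU N) U.1) (pairOfRecord F θ.τ9.M k X)).re| ≤
          (li F θ).C₅ * (li F θ).θ₅ ^ X.1 * Real.exp (-((li F θ).κ * (domSys (F.P k) θ.τ9.M X.1).dj X.2)) :=
  Iff.rfl

/-- **N18's STATEMENT OF RECORD AT THE ADMISSIBLE READING, IN CLOSED FORM** [bookkeeping; module 10 §1 `s_N18_readingOfRecord₁₂_iff_w1` at `w1 := ReadingData.ofRecordAdm …`, by `rfl`]: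
`S_N18 (RRec₁₂ 𝔯_adm)` ⇔ for every family `F`, every datum of record `D` with Stage-12 key `h` (`θ := h.params`), every run length `k`, member `b ∈ ]0, θ.γ]`,
history `g ∈ ]0, θ.γ]^ℕ`, every ADMISSIBLE run-B gauge field `U` of the `(k+1)`-th torus (`AdmBg`: read inside the table `sp F θ (k+1)`) and every run-A domain `(j, X)`:
`|Re E^{(j)}_{S_k}(X; g; (ι(T₀ U), 0)) − Re E^{(j+1)}_{S_{k+1}}(πX; b∷g; (ιU, 0))| ≤ C₅ · θ₅ ^ j · e^{−κ·d_j(X)}` — the η-rate of the one-step outputs as functionals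
of the background, asked exactly for the configurations in the analyticity domains ([I] p. 263).  NOT PRINTED; NOT proved.
[cite: Balaban1987RG1, Thm 1 p.259, (1.11)–(1.16) p.262 and (1.18) p.263; Balaban1988RG2Cluster, (2.13) p.14 and (2.16)–(2.18) p.16] -/
theorem s_N18_readingAdm₁₂_iff :
    S_N18 (RRec₁₂ (readingOfRecord₁₂ (fun F θ => ReadingData.ofRecordAdm F θ.τ9.M N (S F θ) (sp F θ) (gauge F θ) (hg F θ) (T₀ F θ) (hT F θ) (li F θ))
      ℓ₃ ne2 ne1)) ↔
      ∀ (F : T4Family) (D : Datum F N) (h : IsDatumOfRecord₁₂C F N D) (k : ℕ) (b : ℝ), 0 < b → b ≤ h.params.γ →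
        ∀ g ∈ Window h.params.γ,
          ∀ (U : {U : GaugeField (F.P (k + 1)) 0 (Node00.SU N) //
              ∀ (j : ℕ) (Y : (domSys (F.P (k + 1)) h.params.τ9.M j).Dom), ofBackgroundC (ιSU N) U ∈ sp F h.params (k + 1) j Y})
            (X : Node00.W1.Dom (F.P k) h.params.τ9.M),
          |(functionalC (S F h.params k) g (ofBackgroundC (ιSU N) (T₀ F h.params k U.1)) X).re -
              (functionalC (S F h.params (k + 1)) (prependCoupling b g) (ofBackgroundC (ιSU N) U.1) (pairOfRecord F h.params.τ9.M k X)).re| ≤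
            (li F h.params).C₅ * (li F h.params).θ₅ ^ X.1 * Real.exp (-((li F h.params).κ * (domSys (F.P k) h.params.τ9.M X.1).dj X.2)) :=
  s_N18_readingOfRecord₁₂_iff_w1 (fun F θ => ReadingData.ofRecordAdm F θ.τ9.M N (S F θ) (sp F θ) (gauge F θ) (hg F θ) (T₀ F θ) (hT F θ) (li F θ)) ℓ₃ ne2 ne1

/-- **WHAT IT HANDS BACK AT A DATUM KEY** [bookkeeping]: the η-rate inequality for the (2.13) terms of the towers of record at the canonical parameter, for an
ADMISSIBLE run-B field. [cite: Balaban1987RG1, Thm 1 p.259 and (1.18) p.263] -/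
theorem rate_of_s_N18_readingAdm₁₂
    (hS : S_N18 (RRec₁₂ (readingOfRecord₁₂ (fun F θ => ReadingData.ofRecordAdm F θ.τ9.M N (S F θ) (sp F θ) (gauge F θ) (hg F θ) (T₀ F θ) (hT F θ) (li F θ))
      ℓ₃ ne2 ne1)))
    {F : T4Family} {D : Datum F N} (hk : IsDatumOfRecord₁₂C F N D) (k : ℕ) {b : ℝ} (hb : 0 < b) (hbγ : b ≤ hk.params.γ) {g : ℕ → ℝ}
    (hgW : g ∈ Window hk.params.γ) {U : GaugeField (F.P (k + 1)) 0 (Node00.SU N)}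
    (hU : ∀ (j : ℕ) (Y : (domSys (F.P (k + 1)) hk.params.τ9.M j).Dom), ofBackgroundC (ιSU N) U ∈ sp F hk.params (k + 1) j Y)
    (X : Node00.W1.Dom (F.P k) hk.params.τ9.M) :
    |(functionalC (S F hk.params k) g (ofBackgroundC (ιSU N) (T₀ F hk.params k U)) X).re -
        (functionalC (S F hk.params (k + 1)) (prependCoupling b g) (ofBackgroundC (ιSU N) U) (pairOfRecord F hk.params.τ9.M k X)).re| ≤
      (li F hk.params).C₅ * (li F hk.params).θ₅ ^ X.1 * Real.exp (-((li F hk.params).κ * (domSys (F.P k) hk.params.τ9.M X.1).dj X.2)) :=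
  (s_N18_readingAdm₁₂_iff S sp gauge hg T₀ hT li ℓ₃ ne2 ne1).1 hS F D hk k b hb hbγ g hgW ⟨U, hU⟩ X

/-- **THE θ-FORM SUFFICIENT CONDITION AT THE ADMISSIBLE READING** [bookkeeping]: the displayed inequality at EVERY admissible Stage-12 tuple with provisos, every
run length, member, history, admissible run-B field and domain gives `S_N18` at the admissible reading. [cite: Balaban1987RG1, Thm 1 p.259 and (1.18) p.263] -/
theorem s_N18_readingAdm₁₂_of_forall
    (h : ∀ (F : T4Family) (θ : Stage12Params F N), θ.Provisos₁₂ F N → θ.Admissible F N → ∀ (k : ℕ) (b : ℝ), 0 < b → b ≤ θ.γ →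
      ∀ g ∈ Window θ.γ, ∀ (U : GaugeField (F.P (k + 1)) 0 (Node00.SU N)),
        (∀ (j : ℕ) (Y : (domSys (F.P (k + 1)) θ.τ9.M j).Dom), ofBackgroundC (ιSU N) U ∈ sp F θ (k + 1) j Y) →
        ∀ X : Node00.W1.Dom (F.P k) θ.τ9.M,
          |(functionalC (S F θ k) g (ofBackgroundC (ιSU N) (T₀ F θ k U)) X).re -
              (functionalC (S F θ (k + 1)) (prependCoupling b g) (ofBackgroundC (ιSU N) U) (pairOfRecord F θ.τ9.M k X)).re| ≤
            (li F θ).C₅ * (li F θ).θ₅ ^ X.1 * Real.exp (-((li F θ).κ * (domSys (F.P k) θ.τ9.M X.1).dj X.2))) :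
    S_N18 (RRec₁₂ (readingOfRecord₁₂ (fun F θ => ReadingData.ofRecordAdm F θ.τ9.M N (S F θ) (sp F θ) (gauge F θ) (hg F θ) (T₀ F θ) (hT F θ) (li F θ))
      ℓ₃ ne2 ne1)) :=
  s_N18_rRec₁₂_of_forall_admissible _ fun F θ hP hA _ _ k b hb hbγ g hgW U X => h F θ hP hA k b hb hbγ g hgW U.1 U.2 X

/-! ## §3 The row AT THE ADMISSIBLE READING: module 11's junction with the embedding clauses discharged -/

open Classical in
/-- **THE ROW AT THE ADMISSIBLE READING WITH THE LEVELS LEAVES PRODUCED FROM THE TOWERS' H-LAYER DATA ON THE SAME TABLES** [bookkeeping; the s1 ∘ s2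
junction in the print's regime].  At the admissible reading on the table family `sp F θ` (towers `S F θ`, W1's maps of record, transports `T₀ F θ` with the clause `hT`):
if at EVERY admissible Stage-12 tuple `θ` with provisos and every run length `k` there are (i) the END's data over the carriers of the ADMISSIBLE level pairing
— data spaces, per-member step models representing (2.13) of activities on the `k`-th torus's catalogue with THE NODE-A MAJORANT AS HYPOTHESIS, L01–L03
on the functionals, rows NE2 ∕ NE3's L07 ∕ L08, the W3 shapes, the located numerals with the levels letters `e·576·K₀(64,8)²·A_A ∕ A_B`, L10, the sharp clause —
and (ii) THE TOWERS' H-LAYER DATA IN THE CONFIGURATION DIRECTION ON THE TABLES `sp F θ k` ∕ `sp F θ (k+1)` — restriction-closed, `AnalyticH` + `Bound238` of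
`S F θ k` ∕ `S F θ (k+1)` at every step with amplitudes `A_A ∕ A_B` and the END's rate, the two STRICT smallness clauses — with the letters `li F θ`
dominating, then `S_N18 (RRec₁₂ 𝔯_adm)`.  NO embedding clause (module 11 §2's `hembA` ∕ `hembB` are projections of the restricted background types), NO
pairing clause (`dj_pairOfRecord`).  §1 once per key and level, then `N18AtByName.n18At_mono` with module 9's `endConstant_nonneg` and module 8's bundle
equation. [cite: Balaban1988RG2Cluster, (2.13) p.14, p.15, (2.16)–(2.18) p.16 and Lemma 3 (2.38) p.20; Balaban1987RG1, (0.24)–(0.25) p.257, (1.18) p.263 and Thm 1 p.259] -/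
theorem s_N18_readingAdm₁₂_of_envelope_bound238
    (h : ∀ (F : T4Family) (θ : Stage12Params F N), θ.Provisos₁₂ F N → θ.Admissible F N → ∀ k : ℕ,
      ∃ (Op : Type) (_ : NormedAddCommGroup Op) (_ : NormedSpace ℂ Op) (Hist : Type) (_ : NormedAddCommGroup Hist) (_ : NormedSpace ℂ Hist)
        (Mb : ℝ → StepModel (LevelPairing.ofRecordAdm F θ.τ9.M N k (sp F θ) (gauge F θ k) (hg F θ k) (T₀ F θ k) (hT F θ k)).carriers Op Hist)
        (act : ℝ → (j : ℕ) → Op × Hist → TDom 4 (domCount (F.P k) θ.τ9.M j) → ℂ) (γ' C3 ε₁ Rd κ A_A A_B E₁ δ δ' θr θ' cH ω ρ₀ B : ℝ) (k₀ : ℕ),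
        -- (i) the END's data over the carriers of the admissible level pairing
        (∀ b : ℝ, 0 < b → b ≤ γ' → ∀ (X : Node00.W1.Dom (F.P k) θ.τ9.M) (z : Op × Hist),
          (Mb b).Out X.1 z.1 z.2 X =
            locE (TTouch (d := 4) (N := domCount (F.P k) θ.τ9.M X.1)) (fun Z : (tsys 4 (domCount (F.P k) θ.τ9.M X.1)).Dom => Z.1)
              (act b X.1 z) X.2.1) ∧
        0 ≤ C3 ∧ 0 ≤ ε₁ ∧ 0 ≤ κ ∧ κ + 2 * (64 * Real.log 162) + 2 ≤ Rd ∧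
        C3 * ε₁ * Real.exp (5 * κ + 1) * K₀ 64 8 * 9 * 64 ≤ 1 ∧
        (∀ b : ℝ, 0 < b → b ≤ γ' → ∀ j, ∀ g ∈ Window γ',
          ∀ (U : (LevelPairing.ofRecordAdm F θ.τ9.M N k (sp F θ) (gauge F θ k) (hg F θ k) (T₀ F θ k) (hT F θ k)).BgB) (q : Op × Hist),
          q ∈ (Mb b).Base j g U →
          ∃ V : Set (Op × Hist), IsOpen V ∧ (Mb b).box j q ⊆ V ∧
            (∀ Z : TDom 4 (domCount (F.P k) θ.τ9.M j), DifferentiableOn ℂ (fun z : Op × Hist => act b j z Z) V) ∧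
            (∀ z ∈ V, ∀ Z : TDom 4 (domCount (F.P k) θ.τ9.M j), ‖act b j z Z‖ ≤ C3 * ε₁ * Real.exp (-(Rd * torusTreeLen Z.1)))) ∧
        (∀ b : ℝ, 0 < b → b ≤ γ' → L01 (Mb b)
          ((LevelPairing.ofRecordAdm F θ.τ9.M N k (sp F θ) (gauge F θ k) (hg F θ k) (T₀ F θ k) (hT F θ k)).EA (S F θ k)) (Window γ')) ∧
        (∀ b : ℝ, 0 < b → b ≤ γ' → L02 (Mb b)
          ((LevelPairing.ofRecordAdm F θ.τ9.M N k (sp F θ) (gauge F θ k) (hg F θ k) (T₀ F θ k) (hT F θ k)).EB (S F θ (k + 1)) b)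
          (Window γ')) ∧
        (∀ b : ℝ, 0 < b → b ≤ γ' → L03 (Mb b)
          ((LevelPairing.ofRecordAdm F θ.τ9.M N k (sp F θ) (gauge F θ k) (hg F θ k) (T₀ F θ k) (hT F θ k)).EB (S F θ (k + 1)) b)
          (Window γ')) ∧
        (∀ b : ℝ, 0 < b → b ≤ γ' → L07 (Mb b) (Window γ') δ θr) ∧
        (∀ b : ℝ, 0 < b → b ≤ γ' → L08 (Mb b) (Window γ') κ (Real.exp 1 * 9 * 64 * K₀ 64 8 ^ 2 * A_B) δ' θr) ∧
        (∀ b : ℝ, 0 < b → b ≤ γ' → L09aff (Mb b) (Window γ')) ∧ (∀ b : ℝ, 0 < b → b ≤ γ' → L09blind (Mb b) (Window γ')) ∧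
        (∀ b : ℝ, 0 < b → b ≤ γ' → L09hom (Mb b) (Window γ')) ∧ (∀ b : ℝ, 0 < b → b ≤ γ' → L09unit (Mb b) (Window γ') κ E₁ cH ω) ∧
        0 < E₁ ∧ 0 ≤ δ + δ' ∧ 0 ≤ θr ∧ θr ≤ θ' ∧ θ' ≤ 1 ∧ 0 ≤ cH ∧ 0 < ω ∧ ρ₀ < 1 ∧
        (δ + δ') * θr ^ k₀ +
            cH * (Real.exp 1 * 9 * 64 * K₀ 64 8 ^ 2 * A_A + Real.exp 1 * 9 * 64 * K₀ 64 8 ^ 2 * A_B) / (1 - ω) ≤ ρ₀ ∧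
        0 ≤ B ∧ (∀ k < k₀, Real.exp 1 * 9 * 64 * K₀ 64 8 ^ 2 * A_A + Real.exp 1 * 9 * 64 * K₀ 64 8 ^ 2 * A_B ≤ B * θr ^ k) ∧
        Real.exp 1 * 9 * 64 * K₀ 64 8 ^ 2 * C3 * cH * ε₁ < (θ' - ω) * (1 - ρ₀) ∧
        -- (ii) the towers' H-layer data in the configuration direction ON THE TABLES, both runs
        (∀ m, SpRestr (sp F θ k (m + 1))) ∧
        (∀ m, (S F θ k m).AnalyticH (box γ' m) (sp F θ k (m + 1))) ∧ (∀ m, (S F θ k m).Bound238 (box γ' m) (sp F θ k (m + 1)) A_A Rd) ∧ 0 ≤ A_A ∧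
        A_A * Real.exp (5 * κ + 1) * K₀ 64 8 * 9 * 64 < 1 ∧
        (∀ m, SpRestr (sp F θ (k + 1) (m + 1))) ∧
        (∀ m, (S F θ (k + 1) m).AnalyticH (box γ' m) (sp F θ (k + 1) (m + 1))) ∧
        (∀ m, (S F θ (k + 1) m).Bound238 (box γ' m) (sp F θ (k + 1) (m + 1)) A_B Rd) ∧
        0 ≤ A_B ∧ A_B * Real.exp (5 * κ + 1) * K₀ 64 8 * 9 * 64 < 1 ∧
        -- the reading's letters dominate the END's
        θ.γ ≤ γ' ∧ (li F θ).κ ≤ κ ∧ θ' ≤ (li F θ).θ₅ ∧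
        (Real.exp 1 * 9 * 64 * K₀ 64 8 ^ 2 * (C3 * ε₁) / (1 - ρ₀) * (δ + δ') + B) * (θ' - ω) /
            (θ' - (ω + Real.exp 1 * 9 * 64 * K₀ 64 8 ^ 2 * (C3 * ε₁) / (1 - ρ₀) * cH)) ≤ (li F θ).C₅) :
    S_N18 (RRec₁₂ (readingOfRecord₁₂ (fun F θ => ReadingData.ofRecordAdm F θ.τ9.M N (S F θ) (sp F θ) (gauge F θ) (hg F θ) (T₀ F θ) (hT F θ) (li F θ))
      ℓ₃ ne2 ne1)) := by
  refine s_N18_rRec₁₂_of_forall_admissible _ fun F θ hP hA g₀ os k => ?_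
  obtain ⟨Op, _, _, Hist, _, _, Mb, act, γ', C3, ε₁, Rd, κ, A_A, A_B, E₁, δ, δ', θr, θ', cH, ω, ρ₀, B, k₀, hrep, hC3, hε₁, hκ, hrate, hKP, hH,
    l01, l02, l03, l07, l08, l09aff, l09blind, l09hom, l09unit, hE₁, hδ, hθ, hθθ', hθ'1, hcH, hω, hρ₀, l10near, hB, l10first, hS, hrestrA,
    hanA, h238A, hAA, hsmallA, hrestrB, hanB, h238B, hAB, hsmallB, hγ, hℓκ, hℓθ, hℓC⟩ := h F θ hP hA k
  have hN := n18At_pairingAdm_of_envelope_bound238 (sp F θ) (gauge F θ k) (hg F θ k) (T₀ F θ k) (hT F θ k) (S F θ k)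
    (S F θ (k + 1)) Mb hrep hC3 hε₁ hκ hrate hKP hH l01 l02 l03 l07 l08 l09aff l09blind l09hom l09unit hE₁ hδ hθ hθθ' hθ'1 hcH hω hρ₀ l10near
    hB l10first hS hrestrA hanA h238A hAA hsmallA hrestrB hanB h238B hAB hsmallB
    ((li F θ).analytic θ.γ).moduli ((li F θ).analytic θ.γ).C₉ ((li F θ).analytic θ.γ).ω (li F θ).cr (li F θ).ρ
  have hW : Window θ.γ ⊆ Window γ' := fun g hgW i => ⟨(hgW i).1, (hgW i).2.trans hγ⟩
  exact (n18At_u3OfRecord₁₂_w1_iff_pairing (pinnedInputs₁₂ (fun F θ => ReadingData.ofRecordAdm F θ.τ9.M N (S F θ) (sp F θ) (gauge F θ) (hg F θ) (T₀ F θ)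
      (hT F θ) (li F θ)) ℓ₃ ne2) F θ g₀ os k).2
    (n18At_mono hN hW hγ hℓκ (hθ.trans hθθ') hℓθ (endConstant_nonneg hC3 hε₁ hδ hcH hρ₀ hB hS) hℓC)

/-! ## §4 Comparison with the all-fields statement of record -/

/-- **THE ALL-FIELDS STATEMENT OF RECORD IMPLIES THE ADMISSIBLE STATEMENT, ANY TABLES** [bookkeeping]: at the same towers, gauges, transports and letters, `S_N18` at
node00-def-W1 g3's all-fields reading of record (`ReadingData.ofRecord`, module 10 §1) implies `S_N18` at the admissible reading for any table family the transports respect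
— the admissible statement restricts the run-B fields to those read inside the table.  The converse is NOT claimed (large fields). [cite: Balaban1987RG1, Thm 1 p.259 and (1.18) p.263; Balaban1988RG2Cluster, (2.16)–(2.18) p.16] -/
theorem s_N18_readingAdm₁₂_of_allFields
    (hS : S_N18 (RRec₁₂ (readingOfRecord₁₂ (fun F θ => ReadingData.ofRecord F θ.τ9.M N (S F θ) (gauge F θ) (hg F θ) (T₀ F θ) (li F θ))
      ℓ₃ ne2 ne1))) :
    S_N18 (RRec₁₂ (readingOfRecord₁₂ (fun F θ => ReadingData.ofRecordAdm F θ.τ9.M N (S F θ) (sp F θ) (gauge F θ) (hg F θ) (T₀ F θ) (hT F θ) (li F θ))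
      ℓ₃ ne2 ne1)) := by
  rw [s_N18_readingAdm₁₂_iff]
  rw [s_N18_readingOfRecord₁₂_iff_w1] at hS
  exact fun F D h k b hb hbγ g hgW U X => hS F D h k b hb hbγ g hgW U.1 X

/-- **ANTITONE IN THE TABLES** [bookkeeping]: if the table family `sp` is entrywise contained in `sp′` (both respected by the transports), then `S_N18` at the
admissible reading on `sp′` implies `S_N18` at the admissible reading on `sp` — fewer run-B fields are admissible for the smaller tables; e.g. from a thickened table (dag-n18-c's
`…N18HLayerW1Thickened`) down to the table itself. [cite: Balaban1987RG1, (1.17)–(1.18) p.263; Balaban1988RG2Cluster, p.15 and (2.16)–(2.18) p.16] -/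
theorem s_N18_readingAdm₁₂_antitone
    (sp' : (F : T4Family) → (θ : Stage12Params F N) → (k j : ℕ) → (domSys (F.P k) θ.τ9.M j).Dom → Set (CPair (F.P k) (MatA N)))
    (hT' : ∀ (F : T4Family) (θ : Stage12Params F N) (k : ℕ) (U : GaugeField (F.P (k + 1)) 0 (Node00.SU N)),
      (∀ (j : ℕ) (Y : (domSys (F.P (k + 1)) θ.τ9.M j).Dom), ofBackgroundC (ιSU N) U ∈ sp' F θ (k + 1) j Y) →
        ∀ (j : ℕ) (X : (domSys (F.P k) θ.τ9.M j).Dom), ofBackgroundC (ιSU N) (T₀ F θ k U) ∈ sp' F θ k j X)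
    (hsub : ∀ (F : T4Family) (θ : Stage12Params F N) (k j : ℕ) (X : (domSys (F.P k) θ.τ9.M j).Dom), sp F θ k j X ⊆ sp' F θ k j X)
    (hS : S_N18 (RRec₁₂ (readingOfRecord₁₂ (fun F θ => ReadingData.ofRecordAdm F θ.τ9.M N (S F θ) (sp' F θ) (gauge F θ) (hg F θ) (T₀ F θ) (hT' F θ) (li F θ))
      ℓ₃ ne2 ne1))) :
    S_N18 (RRec₁₂ (readingOfRecord₁₂ (fun F θ => ReadingData.ofRecordAdm F θ.τ9.M N (S F θ) (sp F θ) (gauge F θ) (hg F θ) (T₀ F θ) (hT F θ) (li F θ))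
      ℓ₃ ne2 ne1)) := by
  rw [s_N18_readingAdm₁₂_iff] at hS ⊢
  exact fun F D h k b hb hbγ g hgW U X => hS F D h k b hb hbγ g hgW ⟨U.1, fun j Y => hsub F h.params (k + 1) j Y (U.2 j Y)⟩ X

/-- **MODULE 10's STATEMENT OF RECORD (TRANSPORT OF RECORD PINNED, ALL FIELDS) IMPLIES THE ADMISSIBLE STATEMENT WITH THE TRANSPORT OF RECORD**
[bookkeeping]: at `T₀ F θ k := transportRaw F k (avOfRecord F N (k+1) 0)` (dag-n18-d's transport of record, [I] (0.8)–(0.10)), for any table family the transport of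
record respects (`hTr`: the averages of the fields read inside `sp (k+1)` are read inside `sp k` — the regularity of averages, DISPLAYED), module 10's
`S_N18 (RRec₁₂ 𝔯_record)` implies `S_N18` at the ADMISSIBLE reading of record. [cite: Balaban1987RG1, (0.8)–(0.10) p.253, Thm 1 p.259 and (1.18) p.263; Balaban1985Averaging, Props. 1–2] -/
theorem s_N18_readingAdmOfRecord₁₂_of_ofRecord
    (hTr : ∀ (F : T4Family) (θ : Stage12Params F N) (k : ℕ) (U : GaugeField (F.P (k + 1)) 0 (Node00.SU N)),
      (∀ (j : ℕ) (Y : (domSys (F.P (k + 1)) θ.τ9.M j).Dom), ofBackgroundC (ιSU N) U ∈ sp F θ (k + 1) j Y) →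
        ∀ (j : ℕ) (X : (domSys (F.P k) θ.τ9.M j).Dom), ofBackgroundC (ιSU N) (transportRaw F k (avOfRecord F N (k + 1) 0) U) ∈ sp F θ k j X)
    (hS : S_N18 (RRec₁₂ (readingOfRecord₁₂ (fun F θ => ReadingData.ofRecord F θ.τ9.M N (S F θ) (gauge F θ) (hg F θ)
      (fun k => transportRaw F k (avOfRecord F N (k + 1) 0)) (li F θ)) ℓ₃ ne2 ne1))) :
    S_N18 (RRec₁₂ (readingOfRecord₁₂ (fun F θ => ReadingData.ofRecordAdm F θ.τ9.M N (S F θ) (sp F θ) (gauge F θ) (hg F θ)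
      (fun k => transportRaw F k (avOfRecord F N (k + 1) 0)) (hTr F θ) (li F θ)) ℓ₃ ne2 ne1)) :=
  s_N18_readingAdm₁₂_of_allFields S sp gauge hg (fun F _ k => transportRaw F k (avOfRecord F N (k + 1) 0)) hTr li ℓ₃ ne2 ne1 hS

/-! ## §5 Honesty: the admissible statement is content only through INHABITED tables -/

/-- **EMPTY TABLE ENTRIES MAKE THE ADMISSIBLE STATEMENT VACUOUS** [honesty]: if at every admissible Stage-12 tuple with provisos and every run length `k` SOME
entry of the run-B table `sp F θ (k+1)` is empty, then no run-B field is admissible and `S_N18` at the admissible reading holds OUTRIGHT, whatever the towers.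
So the admissible statement carries NE5's content exactly through inhabited tables — at the table of record `spaceOfRecord` in the window the unit configuration
IS admissible (`Node00.one_mem_spaceI_stage12`), and a table that is `univ` beyond the run loses nothing; a skeleton quoting the statement NAMES its tables.
[cite: Balaban1987RG1, (1.11)–(1.16) p.262 (bookkeeping; display of degeneracy)] -/
theorem s_N18_readingAdm₁₂_of_forall_exists_empty
    (hempty : ∀ (F : T4Family) (θ : Stage12Params F N), θ.Provisos₁₂ F N → θ.Admissible F N → ∀ k : ℕ,
      ∃ (j : ℕ) (Y : (domSys (F.P (k + 1)) θ.τ9.M j).Dom), sp F θ (k + 1) j Y = ∅) :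
    S_N18 (RRec₁₂ (readingOfRecord₁₂ (fun F θ => ReadingData.ofRecordAdm F θ.τ9.M N (S F θ) (sp F θ) (gauge F θ) (hg F θ) (T₀ F θ) (hT F θ) (li F θ))
      ℓ₃ ne2 ne1)) := by
  refine s_N18_readingAdm₁₂_of_forall S sp gauge hg T₀ hT li ℓ₃ ne2 ne1 fun F θ hP hA k b _ _ g _ U hU X => ?_
  obtain ⟨j, Y, hY⟩ := hempty F θ hP hA k
  exact absurd (hU j Y) (by simp [hY])

end Record

end YMDAG.N18.W1Reading

end
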